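import Summits.KontsevichZagierPeriods.Zeta5Search.Certificates.DualPFComplex
import Summits.KontsevichZagierPeriods.Zeta5Search.Certificates.RecordRayLineStep
import Summits.KontsevichZagierPeriods.Zeta5Search.Certificates.DualSeriesTermBounds
import HarnessLib

/-!
# ζ(5) search — certificates: the profile of `|R_b(x+iY)|` along a horizontal line (record ray)
(cell `pub-zeta5`, certifier 2, generation 2)

HONEST FRAMING: systematic search; no irrationality claim unless certified.

OUR work (Summit side). The two-heights bound for `W(b)`, `U(b)` (`Certificates/EisensteinSolve.lean`) needs a
termwise majorant of `|R_b(k+iY)|`, `k ∈ ℤ`. This file supplies the structural facts: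

* `aeval_numPoly_natB_mul` (generic, natural parameters with `2B_j ≤ B₀+1`): the REDUCED form
  `numPoly_b(z+1)·∏_j W_j(z) = (2z+B₀+2)·P(z)^7`, `P(z) = ∏_{i ≤ B₀}(z+1+i)`, `W_j(z) = ∏_{B_j ≤ i ≤ B₀−B_j}(z+1+i)`;
  hence `R_b(z)·∏_j W_j(z) = (2z+B₀+2)·P(z)` (`Rc_mul_windows`);
* `normSq_Rc_mul` : on the line `z = x + iY`, `|R_b(z)|²·D(x) = Nm(x)` with the explicit products
  `D(x) = ∏_j ∏_{i∈W_j} q(x+1+i)`, `Nm(x) = 4q(x+h)∏_{i≤B₀} q(x+1+i)`, `q(u) = u²+Y²`, `h = (B₀+2)/2`;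
* for the record ray `b = n·(41;17,…,11)` and its partner `b′ = b + e₇` (`BrecE e n`, `e ∈ {0,1}`): the block
  TELESCOPING identities and, with the certificates of `Certificates/RecordRayLineStep*.lean`, the monotonicity
  `|R_b(x+iY)| ≤ |R_b(x+1+iY)|` for `x + h ≤ −1` (`normSq_Rc_step_le`, stated for any height at which the
  certificate `stepDen ≤ stepNum` holds).
-/

noncomputable section

open Finset Complex Polynomial

namespace Summit.KontsevichZagierPeriods.Zeta5Search.RecordLine

open Summit.KontsevichZagierPeriods.Zeta5Search.DualSeries
open Summit.KontsevichZagierPeriods.Zeta5Search.DualSeriesBounds (natB natB_zero natB_succ)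
open Summit.KontsevichZagierPeriods.Zeta5Search.DualPF (Rc)
open Literature.NumberTheory.Transcendental.BallRivoal (pochPoly)

/-! ### The reduced form of the summand (generic natural parameters) -/

/-- The pole block `P(z) = ∏_{i ≤ B₀} (z+1+i)`. -/
def Pz (B₀ : ℕ) (z : ℂ) : ℂ := ∏ i ∈ range (B₀ + 1), (z + 1 + i)

/-- The `j`-th window `W_j(z) = ∏_{B_j ≤ i ≤ B₀−B_j} (z+1+i)`. -/
def Wz (B₀ : ℕ) (B : ℕ → ℕ) (j : ℕ) (z : ℂ) : ℂ := ∏ i ∈ Ico (B j) (B₀ + 1 - B j), (z + 1 + i)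

/-- `aeval (z+1) (pochPoly β m) = ∏_{s<m} (z + 1 + β + s)`. -/
theorem aeval_pochPoly' (β : ℚ) (m : ℕ) (z : ℂ) :
    aeval (z + 1) (pochPoly β m) = ∏ s ∈ range m, (z + 1 + ((β + s : ℚ) : ℂ)) := by
  unfold pochPoly
  rw [map_prod]
  refine prod_congr rfl fun s _ => ?_
  rw [map_add, aeval_X, aeval_C, eq_ratCast]

/-- **Reduced form**: for natural parameters with `2B_j ≤ B₀ + 1`,
`numPoly_b(z+1) · ∏_j W_j(z) = (2z + B₀ + 2) · P(z)^7`. -/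
theorem aeval_numPoly_natB_mul (B₀ : ℕ) (B : ℕ → ℕ) (hreg : ∀ j ∈ range 7, 2 * B j ≤ B₀ + 1) (z : ℂ) :
    aeval (z + 1) (numPoly (natB B₀ B)) * ∏ j ∈ range 7, Wz B₀ B j z =
      (2 * z + B₀ + 2) * Pz B₀ z ^ 7 := by
  unfold numPoly
  rw [map_mul, natB_zero]
  have hlin : aeval (z + 1) (C 2 * X + C ((B₀ : ℤ) : ℚ)) = 2 * z + B₀ + 2 := by
    rw [map_add, map_mul, aeval_C, aeval_X, aeval_C, eq_ratCast, eq_ratCast]; push_cast; ring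
  rw [hlin, map_prod, mul_assoc, ← prod_mul_distrib]
  congr 1
  rw [show Pz B₀ z ^ 7 = ∏ _j ∈ range 7, Pz B₀ z by rw [prod_const, card_range]]
  refine prod_congr rfl fun j hj => ?_
  have hBj : B j ≤ B₀ + 1 - B j := by have := hreg j hj; omega
  have htop : B₀ + 1 - B j ≤ B₀ + 1 := Nat.sub_le _ _
  rw [natB_succ B₀ B hj, Int.toNat_natCast, map_mul, aeval_pochPoly', aeval_pochPoly']
  -- the two Pochhammer blocks as `Ico`-products of `z + 1 + i`
  have h1 : ∏ s ∈ range (B j), (z + 1 + (((0 : ℚ) + s : ℚ) : ℂ)) = ∏ i ∈ Ico 0 (B j), (z + 1 + i) := by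
    rw [Nat.Ico_zero_eq_range]
    refine prod_congr rfl fun s _ => ?_
    push_cast; ring
  have h2 : ∏ s ∈ range (B j), (z + 1 + (((((B₀ : ℤ) - ((B j : ℕ) : ℤ) + 1 : ℤ) : ℚ) + s : ℚ) : ℂ)) =
      ∏ i ∈ Ico (B₀ + 1 - B j) (B₀ + 1), (z + 1 + i) := by
    rw [prod_Ico_eq_prod_range, show B₀ + 1 - (B₀ + 1 - B j) = B j by omega]
    refine prod_congr rfl fun s _ => ?_
    have e : (((B₀ + 1 - B j + s : ℕ) : ℂ)) = (B₀ : ℂ) - (B j : ℂ) + 1 + s := by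
      rw [Nat.cast_add, Nat.cast_sub (by omega)]; push_cast; ring
    rw [e]; push_cast; ring
  rw [h1, h2, Wz, Pz, ← Nat.Ico_zero_eq_range]
  -- concatenate `[0,B_j) ∪ [B_j, B₀+1−B_j) ∪ [B₀+1−B_j, B₀+1)`
  calc (∏ i ∈ Ico 0 (B j), (z + 1 + (i : ℂ))) * (∏ i ∈ Ico (B₀ + 1 - B j) (B₀ + 1), (z + 1 + (i : ℂ))) *
        ∏ i ∈ Ico (B j) (B₀ + 1 - B j), (z + 1 + (i : ℂ))
      = ((∏ i ∈ Ico 0 (B j), (z + 1 + (i : ℂ))) * ∏ i ∈ Ico (B j) (B₀ + 1 - B j), (z + 1 + (i : ℂ))) *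
          ∏ i ∈ Ico (B₀ + 1 - B j) (B₀ + 1), (z + 1 + (i : ℂ)) := by ring
    _ = ∏ i ∈ Ico 0 (B₀ + 1), (z + 1 + (i : ℂ)) := by
        rw [prod_Ico_consecutive _ (Nat.zero_le _) hBj, prod_Ico_consecutive _ (by omega) htop]

/-- **`R_b(z) · ∏_j W_j(z) = (2z + B₀ + 2) · P(z)`** away from the poles. -/
theorem Rc_mul_windows (B₀ : ℕ) (B : ℕ → ℕ) (hreg : ∀ j ∈ range 7, 2 * B j ≤ B₀ + 1) (z : ℂ)
    (hP : Pz B₀ z ≠ 0) :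
    Rc (natB B₀ B) z * ∏ j ∈ range 7, Wz B₀ B j z = (2 * z + B₀ + 2) * Pz B₀ z := by
  have h := aeval_numPoly_natB_mul B₀ B hreg z
  unfold Rc
  rw [natB_zero, Int.toNat_natCast]
  change aeval (z + 1) (numPoly (natB B₀ B)) / Pz B₀ z ^ 6 * ∏ j ∈ range 7, Wz B₀ B j z = _
  rw [div_mul_eq_mul_div, div_eq_iff (pow_ne_zero 6 hP), h]
  ring

/-! ### Squared moduli on the line `z = x + iY` -/

/-- `|x + iY + c|² = (x+c)² + Y²` for real `c`. -/
theorem normSq_line (x Y c : ℝ) : ‖((x : ℂ) + Y * I + c)‖ ^ 2 = qsq Y (x + c) := by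
  have e : (x : ℂ) + Y * I + c = ⟨x + c, Y⟩ := by
    apply Complex.ext <;> simp
  rw [e, Complex.sq_norm, Complex.normSq_mk, qsq]; ring

/-- The denominator product `D(x) = ∏_j ∏_{i ∈ W_j} q(x+1+i)`. -/
def Dx (B₀ : ℕ) (B : ℕ → ℕ) (Y x : ℝ) : ℝ :=
  ∏ j ∈ range 7, ∏ i ∈ Ico (B j) (B₀ + 1 - B j), qsq Y (x + 1 + i)

/-- The numerator product `Nm(x) = 4·q(x+h)·∏_{i ≤ B₀} q(x+1+i)`, `h = (B₀+2)/2`. -/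
def Nm (B₀ : ℕ) (Y x : ℝ) : ℝ :=
  4 * qsq Y (x + ((B₀ : ℝ) + 2) / 2) * ∏ i ∈ range (B₀ + 1), qsq Y (x + 1 + i)

/-- `D(x) > 0`. -/
theorem Dx_pos (B₀ : ℕ) (B : ℕ → ℕ) {Y : ℝ} (hY : 0 < Y) (x : ℝ) : 0 < Dx B₀ B Y x := by
  unfold Dx qsq; exact prod_pos fun _ _ => prod_pos fun _ _ => by positivity

/-- `Nm(x) > 0`. -/
theorem Nm_pos (B₀ : ℕ) {Y : ℝ} (hY : 0 < Y) (x : ℝ) : 0 < Nm B₀ Y x := by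
  unfold Nm qsq
  exact mul_pos (by positivity) (prod_pos fun _ _ => by positivity)

/-- `|∏_j W_j(x+iY)|² = D(x)`. -/
theorem normSq_windows (B₀ : ℕ) (B : ℕ → ℕ) (x Y : ℝ) :
    ‖∏ j ∈ range 7, Wz B₀ B j ((x : ℂ) + Y * I)‖ ^ 2 = Dx B₀ B Y x := by
  rw [norm_prod, ← prod_pow, Dx]
  refine prod_congr rfl fun j _ => ?_
  rw [Wz, norm_prod, ← prod_pow]
  refine prod_congr rfl fun i _ => ?_
  rw [show (x : ℂ) + Y * I + 1 + (i : ℂ) = (x : ℂ) + Y * I + ((1 + i : ℝ) : ℂ) by push_cast; ring,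
    normSq_line, add_assoc]

/-- `|(2z + B₀ + 2)·P(z)|² = Nm(x)` on the line. -/
theorem normSq_numerator (B₀ : ℕ) (x Y : ℝ) :
    ‖(2 * ((x : ℂ) + Y * I) + B₀ + 2) * Pz B₀ ((x : ℂ) + Y * I)‖ ^ 2 = Nm B₀ Y x := by
  rw [norm_mul, mul_pow, Pz, norm_prod, ← prod_pow, Nm]
  congr 1
  · have e : (2 * ((x : ℂ) + Y * I) + B₀ + 2) = 2 * ((x : ℂ) + Y * I + ((((B₀ : ℝ) + 2) / 2 : ℝ) : ℂ)) := by
      push_cast; ring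
    rw [e, norm_mul, mul_pow, normSq_line]
    norm_num
  · refine prod_congr rfl fun i _ => ?_
    rw [show (x : ℂ) + Y * I + 1 + (i : ℂ) = (x : ℂ) + Y * I + ((1 + i : ℝ) : ℂ) by push_cast; ring,
      normSq_line, add_assoc]

/-- `P(x+iY) ≠ 0` for `Y ≠ 0`. -/
theorem Pz_line_ne_zero (B₀ : ℕ) {x Y : ℝ} (hY : Y ≠ 0) : Pz B₀ ((x : ℂ) + Y * I) ≠ 0 := by
  unfold Pz
  refine prod_ne_zero_iff.2 fun i _ h0 => ?_
  have := congrArg Complex.im h0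
  simp at this
  exact hY this

/-- **`|R_b(x+iY)|² · D(x) = Nm(x)`** (natural parameters, `2B_j ≤ B₀+1`, `Y ≠ 0`). -/
theorem normSq_Rc_mul (B₀ : ℕ) (B : ℕ → ℕ) (hreg : ∀ j ∈ range 7, 2 * B j ≤ B₀ + 1) {x Y : ℝ}
    (hY : Y ≠ 0) :
    ‖Rc (natB B₀ B) ((x : ℂ) + Y * I)‖ ^ 2 * Dx B₀ B Y x = Nm B₀ Y x := by
  have h := Rc_mul_windows B₀ B hreg _ (Pz_line_ne_zero B₀ (x := x) hY)
  have h2 := congrArg (fun w : ℂ => ‖w‖ ^ 2) h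
  simp only [norm_mul, mul_pow] at h2
  rw [normSq_windows] at h2
  rw [h2, ← mul_pow, ← norm_mul, normSq_numerator]

/-! ### The record ray and its partner: block telescoping and the monotone step -/

/-- The slots of the record direction with the seventh slot shifted by `e`:
`B j = (17 − j)·n` for `j < 6`, `B 6 = 11n + e` (`e = 0`: `b`, `e = 1`: the partner `b′ = b + e₇`). -/
def BrecE (e n : ℕ) : ℕ → ℕ := fun j => (17 - j) * n + if j = 6 then e else 0

/-- `2B_j ≤ B₀ + 1` on the record direction and its partner (`e ≤ 1`, `n ≥ 1`). -/
theorem hreg_recE {e n : ℕ} (he : e ≤ 1) (hn : 1 ≤ n) : ∀ j ∈ range 7, 2 * BrecE e n j ≤ 41 * n + 1 := by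
  intro j hj
  have hj' := mem_range.1 hj
  unfold BrecE
  split_ifs with h6
  · subst h6; omega
  · have : 17 - j ≤ 17 := Nat.sub_le 17 j
    nlinarith

/-- Block telescoping: `q(x+1+a)·∏_{i∈[a,b)} q(x+2+i) = (∏_{i∈[a,b)} q(x+1+i))·q(x+1+b)` for `a ≤ b`. -/
theorem block_telescope (Y x : ℝ) {a b : ℕ} (hab : a ≤ b) :
    qsq Y (x + 1 + a) * ∏ i ∈ Ico a b, qsq Y (x + 1 + 1 + i) =
      (∏ i ∈ Ico a b, qsq Y (x + 1 + i)) * qsq Y (x + 1 + b) := by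
  have hshift : ∏ i ∈ Ico a b, qsq Y (x + 1 + 1 + i) = ∏ i ∈ Ico (a + 1) (b + 1), qsq Y (x + 1 + i) := by
    rw [← prod_Ico_add' (fun i : ℕ => qsq Y (x + 1 + i)) a b 1]
    refine prod_congr rfl fun i _ => ?_
    push_cast; ring_nf
  rw [hshift, ← prod_Ico_succ_top hab, prod_eq_prod_Ico_succ_bot (Nat.lt_succ_of_le hab)]

/-- Telescoping of the numerator: `Nm(x+1)·q(x+h)·q(x+1) = Nm(x)·q(x+1+h)·q(x+2+B₀)`. -/
theorem Nm_step (B₀ : ℕ) (Y x : ℝ) :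
    Nm B₀ Y (x + 1) * (qsq Y (x + ((B₀ : ℝ) + 2) / 2) * qsq Y (x + 1)) =
      Nm B₀ Y x * (qsq Y (x + 1 + ((B₀ : ℝ) + 2) / 2) * qsq Y (x + 1 + ((B₀ + 1 : ℕ) : ℝ))) := by
  have h := block_telescope Y x (Nat.zero_le (B₀ + 1))
  rw [Nat.Ico_zero_eq_range] at h
  unfold Nm
  have e1 : ∏ i ∈ range (B₀ + 1), qsq Y (x + 1 + 1 + (i : ℝ)) = ∏ i ∈ range (B₀ + 1), qsq Y (x + 1 + 1 + i) := rfl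
  push_cast at h ⊢
  have h' : qsq Y (x + 1) * ∏ i ∈ range (B₀ + 1), qsq Y (x + 1 + 1 + (i : ℝ)) =
      (∏ i ∈ range (B₀ + 1), qsq Y (x + 1 + (i : ℝ))) * qsq Y (x + 1 + ((B₀ : ℝ) + 1)) := by
    simpa using h
  calc 4 * qsq Y (x + 1 + ((B₀ : ℝ) + 2) / 2) * (∏ i ∈ range (B₀ + 1), qsq Y (x + 1 + 1 + (i : ℝ))) *
        (qsq Y (x + ((B₀ : ℝ) + 2) / 2) * qsq Y (x + 1))
      = 4 * qsq Y (x + 1 + ((B₀ : ℝ) + 2) / 2) * qsq Y (x + ((B₀ : ℝ) + 2) / 2) *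
          (qsq Y (x + 1) * ∏ i ∈ range (B₀ + 1), qsq Y (x + 1 + 1 + (i : ℝ))) := by ring
    _ = 4 * qsq Y (x + 1 + ((B₀ : ℝ) + 2) / 2) * qsq Y (x + ((B₀ : ℝ) + 2) / 2) *
          ((∏ i ∈ range (B₀ + 1), qsq Y (x + 1 + (i : ℝ))) * qsq Y (x + 1 + ((B₀ : ℝ) + 1))) := by rw [h']
    _ = _ := by ring

/-- Telescoping of the denominator: `D(x+1)·∏_j q(x+1+B_j) = D(x)·∏_j q(x+2+B₀−B_j)`. -/
theorem Dx_step (B₀ : ℕ) (B : ℕ → ℕ) (hreg : ∀ j ∈ range 7, 2 * B j ≤ B₀ + 1) (Y x : ℝ) :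
    Dx B₀ B Y (x + 1) * ∏ j ∈ range 7, qsq Y (x + 1 + (B j : ℝ)) =
      Dx B₀ B Y x * ∏ j ∈ range 7, qsq Y (x + 1 + ((B₀ + 1 - B j : ℕ) : ℝ)) := by
  unfold Dx
  rw [← prod_mul_distrib, ← prod_mul_distrib]
  refine prod_congr rfl fun j hj => ?_
  have hab : B j ≤ B₀ + 1 - B j := by have := hreg j hj; omega
  have h := block_telescope Y x hab
  rw [mul_comm, h]

section Step

variable (e n : ℕ) (Y : ℝ)

/-- `q` only sees the square of its argument. -/
theorem qsq_congr {Y u v : ℝ} (h : u ^ 2 = v ^ 2) : qsq Y u = qsq Y v := by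
  unfold qsq; rw [h]

/-- The certificate's numerator in the variable `x` (`a = −x − h − 1/2`, `h = (41n+2)/2`):
`stepNum = q(x+1+h)·q(x+2+41n)·∏_j q(x+1+B_j)`. -/
theorem stepNum_eq (x : ℝ) :
    stepNum e n Y (-x - ((41 * n : ℕ) + 2 : ℝ) / 2 - 1 / 2) =
      qsq Y (x + 1 + (((41 * n : ℕ) : ℝ) + 2) / 2) * qsq Y (x + 1 + ((41 * n + 1 : ℕ) : ℝ)) *
        ∏ j ∈ range 7, qsq Y (x + 1 + (BrecE e n j : ℝ)) := by
  unfold stepNum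
  simp only [prod_range_succ, prod_range_zero, one_mul, BrecE]
  push_cast
  rw [qsq_congr (show (-x - (41 * (n : ℝ) + 2) / 2 - 1 / 2 - 1 / 2) ^ 2 = (x + 1 + (41 * (n : ℝ) + 2) / 2) ^ 2 by ring),
    qsq_congr (show (41 / 2 * (n : ℝ) + 1 / 2 - (-x - (41 * (n : ℝ) + 2) / 2 - 1 / 2)) ^ 2 =
      (x + 1 + (41 * (n : ℝ) + 1)) ^ 2 by ring),
    qsq_congr (show (7 / 2 * (n : ℝ) + 1 / 2 + (-x - (41 * (n : ℝ) + 2) / 2 - 1 / 2)) ^ 2 =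
      (x + 1 + (17 * (n : ℝ) + 0)) ^ 2 by ring),
    qsq_congr (show (9 / 2 * (n : ℝ) + 1 / 2 + (-x - (41 * (n : ℝ) + 2) / 2 - 1 / 2)) ^ 2 =
      (x + 1 + (16 * (n : ℝ) + 0)) ^ 2 by ring),
    qsq_congr (show (11 / 2 * (n : ℝ) + 1 / 2 + (-x - (41 * (n : ℝ) + 2) / 2 - 1 / 2)) ^ 2 =
      (x + 1 + (15 * (n : ℝ) + 0)) ^ 2 by ring),
    qsq_congr (show (13 / 2 * (n : ℝ) + 1 / 2 + (-x - (41 * (n : ℝ) + 2) / 2 - 1 / 2)) ^ 2 =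
      (x + 1 + (14 * (n : ℝ) + 0)) ^ 2 by ring),
    qsq_congr (show (15 / 2 * (n : ℝ) + 1 / 2 + (-x - (41 * (n : ℝ) + 2) / 2 - 1 / 2)) ^ 2 =
      (x + 1 + (13 * (n : ℝ) + 0)) ^ 2 by ring),
    qsq_congr (show (17 / 2 * (n : ℝ) + 1 / 2 + (-x - (41 * (n : ℝ) + 2) / 2 - 1 / 2)) ^ 2 =
      (x + 1 + (12 * (n : ℝ) + 0)) ^ 2 by ring),
    qsq_congr (show (19 / 2 * (n : ℝ) + 1 / 2 - (e : ℝ) + (-x - (41 * (n : ℝ) + 2) / 2 - 1 / 2)) ^ 2 =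
      (x + 1 + (11 * (n : ℝ) + (e : ℝ))) ^ 2 by ring)]

/-- The certificate's denominator in the variable `x`: `stepDen = q(x+h)·q(x+1)·∏_j q(x+2+41n−B_j)`. -/
theorem stepDen_eq (x : ℝ) (he : e ≤ 1) (hn : 1 ≤ n) :
    stepDen e n Y (-x - ((41 * n : ℕ) + 2 : ℝ) / 2 - 1 / 2) =
      qsq Y (x + (((41 * n : ℕ) : ℝ) + 2) / 2) * qsq Y (x + 1) *
        ∏ j ∈ range 7, qsq Y (x + 1 + ((41 * n + 1 - BrecE e n j : ℕ) : ℝ)) := by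
  unfold stepDen
  simp only [prod_range_succ, prod_range_zero, one_mul, BrecE]
  push_cast
  have c0 : ((41 * n + 1 - (17 * n + 0) : ℕ) : ℝ) = 24 * n + 1 := by
    rw [Nat.cast_sub (by omega)]; push_cast; ring
  have c1 : ((41 * n + 1 - (16 * n + 0) : ℕ) : ℝ) = 25 * n + 1 := by
    rw [Nat.cast_sub (by omega)]; push_cast; ring
  have c2 : ((41 * n + 1 - (15 * n + 0) : ℕ) : ℝ) = 26 * n + 1 := by
    rw [Nat.cast_sub (by omega)]; push_cast; ring
  have c3 : ((41 * n + 1 - (14 * n + 0) : ℕ) : ℝ) = 27 * n + 1 := by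
    rw [Nat.cast_sub (by omega)]; push_cast; ring
  have c4 : ((41 * n + 1 - (13 * n + 0) : ℕ) : ℝ) = 28 * n + 1 := by
    rw [Nat.cast_sub (by omega)]; push_cast; ring
  have c5 : ((41 * n + 1 - (12 * n + 0) : ℕ) : ℝ) = 29 * n + 1 := by
    rw [Nat.cast_sub (by omega)]; push_cast; ring
  have c6 : ((41 * n + 1 - (11 * n + e) : ℕ) : ℝ) = 30 * n + 1 - e := by
    rw [Nat.cast_sub (by omega)]; push_cast; ring
  rw [c0, c1, c2, c3, c4, c5, c6]
  rw [qsq_congr (show (-x - (41 * (n : ℝ) + 2) / 2 - 1 / 2 + 1 / 2) ^ 2 = (x + (41 * (n : ℝ) + 2) / 2) ^ 2 by ring),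
    qsq_congr (show (41 / 2 * (n : ℝ) + 1 / 2 + (-x - (41 * (n : ℝ) + 2) / 2 - 1 / 2)) ^ 2 = (x + 1) ^ 2 by ring),
    qsq_congr (show (7 / 2 * (n : ℝ) + 1 / 2 - (-x - (41 * (n : ℝ) + 2) / 2 - 1 / 2)) ^ 2 =
      (x + 1 + (24 * (n : ℝ) + 1)) ^ 2 by ring),
    qsq_congr (show (9 / 2 * (n : ℝ) + 1 / 2 - (-x - (41 * (n : ℝ) + 2) / 2 - 1 / 2)) ^ 2 =
      (x + 1 + (25 * (n : ℝ) + 1)) ^ 2 by ring),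
    qsq_congr (show (11 / 2 * (n : ℝ) + 1 / 2 - (-x - (41 * (n : ℝ) + 2) / 2 - 1 / 2)) ^ 2 =
      (x + 1 + (26 * (n : ℝ) + 1)) ^ 2 by ring),
    qsq_congr (show (13 / 2 * (n : ℝ) + 1 / 2 - (-x - (41 * (n : ℝ) + 2) / 2 - 1 / 2)) ^ 2 =
      (x + 1 + (27 * (n : ℝ) + 1)) ^ 2 by ring),
    qsq_congr (show (15 / 2 * (n : ℝ) + 1 / 2 - (-x - (41 * (n : ℝ) + 2) / 2 - 1 / 2)) ^ 2 =
      (x + 1 + (28 * (n : ℝ) + 1)) ^ 2 by ring),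
    qsq_congr (show (17 / 2 * (n : ℝ) + 1 / 2 - (-x - (41 * (n : ℝ) + 2) / 2 - 1 / 2)) ^ 2 =
      (x + 1 + (29 * (n : ℝ) + 1)) ^ 2 by ring),
    qsq_congr (show (19 / 2 * (n : ℝ) + 1 / 2 - (e : ℝ) - (-x - (41 * (n : ℝ) + 2) / 2 - 1 / 2)) ^ 2 =
      (x + 1 + (30 * (n : ℝ) + 1 - (e : ℝ))) ^ 2 by ring)]

end Step

/-- **THE MONOTONE STEP.** If the certificate `stepDen ≤ stepNum` holds at the offset `a = −x−h−1/2`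
(`Certificates/RecordRayLineStep*`: all `a ≥ 1/2`, `n ≥ 1`, heights `3n`, `3n+1`), then
`|R_b(x+iY)|² ≤ |R_b(x+1+iY)|²` for the record ray (`e = 0`) / its partner (`e = 1`). -/
theorem normSq_Rc_step_le {e n : ℕ} (he : e ≤ 1) (hn : 1 ≤ n) {Y : ℝ} (hY : 0 < Y) (x : ℝ)
    (hcert : stepDen e n Y (-x - ((41 * n : ℕ) + 2 : ℝ) / 2 - 1 / 2) ≤
      stepNum e n Y (-x - ((41 * n : ℕ) + 2 : ℝ) / 2 - 1 / 2)) :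
    ‖Rc (natB (41 * n) (BrecE e n)) ((x : ℂ) + Y * I)‖ ^ 2 ≤
      ‖Rc (natB (41 * n) (BrecE e n)) (((x + 1 : ℝ) : ℂ) + Y * I)‖ ^ 2 := by
  set B₀ := 41 * n with hB₀
  have hreg := hreg_recE he hn
  have h0 := normSq_Rc_mul B₀ (BrecE e n) hreg (x := x) hY.ne'
  have h1 := normSq_Rc_mul B₀ (BrecE e n) hreg (x := x + 1) hY.ne'
  have hD0 := Dx_pos B₀ (BrecE e n) hY x
  have hD1 := Dx_pos B₀ (BrecE e n) hY (x + 1)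
  -- the step identities
  have hN := Nm_step B₀ Y x
  have hD := Dx_step B₀ (BrecE e n) hreg Y x
  rw [stepNum_eq, stepDen_eq e n Y x he hn] at hcert
  -- positivity of the common factors
  have hc : 0 < ∏ j ∈ range 7, qsq Y (x + 1 + (BrecE e n j : ℝ)) := prod_pos fun _ _ => by unfold qsq; positivity
  have hq1 : 0 < qsq Y (x + (((41 * n : ℕ) : ℝ) + 2) / 2) * qsq Y (x + 1) := by unfold qsq; positivity
  -- `Nm(x+1)·D(x) ≥ Nm(x)·D(x+1)`
  have key : Nm B₀ Y x * Dx B₀ (BrecE e n) Y (x + 1) ≤ Nm B₀ Y (x + 1) * Dx B₀ (BrecE e n) Y x := by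
    -- multiply the certificate by `Nm(x)·D(x) > 0` and use the telescoping identities
    have hNm := Nm_pos B₀ hY x
    have := mul_le_mul_of_nonneg_left hcert (mul_pos hNm hD0).le
    -- rewrite both sides
    have lhs : Nm B₀ Y x * Dx B₀ (BrecE e n) Y x *
        (qsq Y (x + (((41 * n : ℕ) : ℝ) + 2) / 2) * qsq Y (x + 1) *
          ∏ j ∈ range 7, qsq Y (x + 1 + ((41 * n + 1 - BrecE e n j : ℕ) : ℝ))) =
        (Nm B₀ Y x * Dx B₀ (BrecE e n) Y (x + 1)) *
          ((qsq Y (x + (((41 * n : ℕ) : ℝ) + 2) / 2) * qsq Y (x + 1)) *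
            ∏ j ∈ range 7, qsq Y (x + 1 + (BrecE e n j : ℝ))) := by
      rw [hB₀] at hD ⊢
      calc Nm (41 * n) Y x * Dx (41 * n) (BrecE e n) Y x *
            (qsq Y (x + (((41 * n : ℕ) : ℝ) + 2) / 2) * qsq Y (x + 1) *
              ∏ j ∈ range 7, qsq Y (x + 1 + ((41 * n + 1 - BrecE e n j : ℕ) : ℝ)))
          = Nm (41 * n) Y x * (qsq Y (x + (((41 * n : ℕ) : ℝ) + 2) / 2) * qsq Y (x + 1)) *
              (Dx (41 * n) (BrecE e n) Y x *
                ∏ j ∈ range 7, qsq Y (x + 1 + ((41 * n + 1 - BrecE e n j : ℕ) : ℝ))) := by ring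
        _ = Nm (41 * n) Y x * (qsq Y (x + (((41 * n : ℕ) : ℝ) + 2) / 2) * qsq Y (x + 1)) *
              (Dx (41 * n) (BrecE e n) Y (x + 1) * ∏ j ∈ range 7, qsq Y (x + 1 + (BrecE e n j : ℝ))) := by
            rw [hD]
        _ = _ := by ring
    have rhs : Nm B₀ Y x * Dx B₀ (BrecE e n) Y x *
        (qsq Y (x + 1 + (((41 * n : ℕ) : ℝ) + 2) / 2) * qsq Y (x + 1 + ((41 * n + 1 : ℕ) : ℝ)) *
          ∏ j ∈ range 7, qsq Y (x + 1 + (BrecE e n j : ℝ))) =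
        (Nm B₀ Y (x + 1) * Dx B₀ (BrecE e n) Y x) *
          ((qsq Y (x + (((41 * n : ℕ) : ℝ) + 2) / 2) * qsq Y (x + 1)) *
            ∏ j ∈ range 7, qsq Y (x + 1 + (BrecE e n j : ℝ))) := by
      rw [hB₀] at hN ⊢
      push_cast at hN ⊢
      calc Nm (41 * n) Y x * Dx (41 * n) (BrecE e n) Y x *
            (qsq Y (x + 1 + ((41 : ℝ) * n + 2) / 2) * qsq Y (x + 1 + ((41 : ℝ) * n + 1)) *
              ∏ j ∈ range 7, qsq Y (x + 1 + (BrecE e n j : ℝ)))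
          = (Nm (41 * n) Y x * (qsq Y (x + 1 + ((41 : ℝ) * n + 2) / 2) * qsq Y (x + 1 + ((41 : ℝ) * n + 1)))) *
              Dx (41 * n) (BrecE e n) Y x * ∏ j ∈ range 7, qsq Y (x + 1 + (BrecE e n j : ℝ)) := by ring
        _ = (Nm (41 * n) Y (x + 1) * (qsq Y (x + ((41 : ℝ) * n + 2) / 2) * qsq Y (x + 1))) *
              Dx (41 * n) (BrecE e n) Y x * ∏ j ∈ range 7, qsq Y (x + 1 + (BrecE e n j : ℝ)) := by
            rw [hN]
        _ = _ := by ring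
    rw [lhs, rhs] at this
    exact le_of_mul_le_mul_right this (mul_pos hq1 hc)
  -- divide by `D(x)·D(x+1)`
  have eq0 : ‖Rc (natB B₀ (BrecE e n)) ((x : ℂ) + Y * I)‖ ^ 2 = Nm B₀ Y x / Dx B₀ (BrecE e n) Y x := by
    rw [eq_div_iff hD0.ne']; exact h0
  have eq1 : ‖Rc (natB B₀ (BrecE e n)) (((x + 1 : ℝ) : ℂ) + Y * I)‖ ^ 2 =
      Nm B₀ Y (x + 1) / Dx B₀ (BrecE e n) Y (x + 1) := by
    rw [eq_div_iff hD1.ne']; exact h1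
  rw [eq0, eq1, div_le_div_iff₀ hD0 hD1]
  exact key

end Summit.KontsevichZagierPeriods.Zeta5Search.RecordLine
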